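import Summits.CriticalPhenomena.PercolationContinuityZ3.Theorems.Transplant.SkelFrmFrom1ChoiceLTKPx
import HarnessLib

/-!
# GEN ROW (RULING D-Us, lead g21 V147b / Us-R1–R2 lead g22; WAVE-Us-MANIFEST v1.0 §3 level 0 / §5) «PlanarSkeletonFrmFrom1Px» — the GENERALISED twins of the level-0
# NORMAL FORMS («PlanarSkeletonFrm1» / «SkelFrmFrom1Closure» §1: `…_iff_critical`, `…_iff_minimal'`, `…_of_subexponential_case'`, `continuity_of_frmNode₁`), POINTWISE:
# **from the four GEN column obligations at proxy radius `D` to `θ_t(p_c) = 0` and to the same-`p` drop — for every skeleton with proxies, and for the COARSE skeleton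
# of a one-type scaled skeleton with `L ≤ N`** (the plumbing between the GEN closure top and the U_s node's rider form; the node itself = Us-4, LEAD-GATED, NOT here)

builds on p205010 (kernel theorem, internal audit signed; external expert review pending) — §2–§3 use Hutchcroft's theorem (exponential growth) and Burton–Keane (amenable
uniqueness) exactly as U's `samePDropOfSkeletonFrmFrom₁_iff_minimal'` does; CONDITIONAL closures (hypotheses = a GEN choice function at radius `D` meeting
`GeomHoldsNQFnPxAt` / `RootHoldsNQWFnLKPxAt` / `FaceHoldsRNQFnLTKPxAt` / `ReachHoldsRHNQFnLKPxAt`, resp. a `D`-indexed family of such for §3); NOTHING about the OPEN nodes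
U (`SamePDropOfSkeletonFrmFrom₁`) / U_s (`SamePDropOfSkeletonFrmScaled₁`) is claimed; no statement, no `@[conjecture]`, def-free.  Lane `prim-bschramm`, seat
`prim-bschramm-gen-1` g0 (GEN pen); helper file (`--supports stmt-CriticalPhenomena-4575 --as helper`); NEW TEXT (the U level-0 normal forms are `↔`-statements about the
∀-quantified node; their GEN twins are the pointwise implications below — hunk class (i) `h1 ↦ hP`, nothing else).
* §1 `drop_at_of_critical` — pure percolation plumbing at one `(G, t)`: if `θ_t(p_c) = 0` whenever a predicate `P` holds at `p_c`, then at every `p` with `P p` and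
  `θ_t(p) > 0` some `q < p` has `θ_t(q) > 0` (the body of `samePDropOfSkeletonFrmScaled₁_iff_critical`, `.2`, pointwise).
* §2 `PlanarSkeletonFrmFrom.theta_criticalProbIOf_eq_zero_of_choiceFnNQLTKPxAt` — multi-type carrier, base type WITH PROXIES at radius `D`, Φ2 at `p_c` ⇒ `θ_t(p_c) = 0`
  (growth split: Hutchcroft / the GEN closure top «SkelFrmFrom1ChoiceLTKPx» with `p_c < 1`, Burton–Keane uniqueness and `0 < p_c` from «PlanarSkeletonFrmFrom1»); and
  `…drop_of_choiceFnNQLTKPxAt_at` — the drop at every `p` with Φ2 and `θ_t(p) > 0` (NO growth / uniqueness / `p < 1` hypotheses: §1 ∘ §2).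
* §3 `PlanarSkeletonFrmScaled.theta_criticalProbIOf_eq_zero_of_choiceFnNQLTKPxAt` / `…drop_of_choiceFnNQLTKPxAt_at` — ONE-TYPE SCALED skeleton with `L ≤ N` on a
  connected graph: the coarse skeleton `Φ.coarseFrmFrom h1 hLN` (dictionary part 5) is a `PlanarSkeletonFrmFrom` with `t ∈ types`, proxies at SOME radius `D`
  (`hasProxies_coarseFrmFrom`) and Φ2 transferred (`coarseFrmFrom_cylSubcritical`) — so a `D`-INDEXED FAMILY of GEN choice functions meeting the four obligations at every
  `D` gives `θ_t(p_c) = 0` / the drop for the ORIGINAL graph.  THIS IS THE SHAPE THE U_s NODE (rider form `…Scaled₁_of_le`, WAVE-Us-MANIFEST §5) INSTANTIATES at the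
  choice function of record `fun D => frmChoiceAllQ3VPx D (tuple D)` and the four GEN column tops — one line, when they exist and the lead opens Us-4.
[cite: BenjaminiSchramm1996, Conj. 4] [cite: KozmaNitzan2024, §1 p. 2 (approach 1); §4 Theorem 6] [cite: Hutchcroft2016, Thm. 1] [cite: LyonsPeres2016, Thm. 7.6]
[cite: BurtonKeane1989, Thm. 2] [cite: MartineauSevero2019, Cor. 2.2] [this work]
-/

noncomputable section

namespace Summit.CriticalPhenomena.PercolationContinuityZ3.Theorems.Transplant

open MeasureTheory Literature.Probability.Percolation Literature.Probability.LatticeModels SimpleGraph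
open Literature.Barriers.CriticalPhenomena (IsQuasiTransitive IsGraphAmenable HasExponentialGrowth
  hasExponentialGrowth_of_not_isGraphAmenable BurtonKeane1989_atMostOneInfiniteCluster_holds Hutchcroft2016_noPercolationAtCriticality_holds
  countable_of_connected_of_locallyFinite)
open scoped Classical

/-! ## §1 Percolation plumbing at one vertex: the drop from `θ(p_c) = 0` -/

/-- **The same-`p` drop at one `(G, t)` from continuity at `p_c`**: if `θ_t(p_c) = 0` whenever `P` holds at `p_c`, then every density `p` with `P p` and `θ_t(p) > 0` has
some `q < p` with `θ_t(q) > 0` — `p ≥ p_c` since `θ_t` vanishes below `p_c`; `p = p_c` is excluded by the hypothesis; for `p > p_c` take the midpoint.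
(The body of `samePDropOfSkeletonFrmScaled₁_iff_critical` `.2`, pointwise.) [cite: BenjaminiSchramm1996, Conj. 4] [cite: KozmaNitzan2024, §1 p. 2 (approach 1)] -/
theorem drop_at_of_critical {V : Type} [Countable V] (G : SimpleGraph V) (t : V) {P : unitInterval → Prop}
    (hK : P (criticalProbIOf G t) → theta G t (criticalProbIOf G t) = 0) (p : unitInterval) (hPp : P p) (hθ : 0 < theta G t p) :
    ∃ q : unitInterval, (q : ℝ) < p ∧ 0 < theta G t q := by
  have hge : criticalProb G t ≤ p := not_lt.1 fun hlt => hθ.ne' (theta_eq_zero_of_lt_criticalProb_holds G t p hlt)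
  rcases hge.lt_or_eq with hlt | heq
  · have hpc0 : 0 ≤ criticalProb G t := (criticalProb_mem_Icc G t).1
    have hp0 : 0 ≤ (p : ℝ) := p.2.1
    have hq1 : (criticalProb G t + p) / 2 ≤ 1 := by linarith [p.2.2]
    refine ⟨⟨(criticalProb G t + p) / 2, by positivity, hq1⟩, ?_, ?_⟩
    · show (criticalProb G t + (p : ℝ)) / 2 < p
      linarith
    · exact theta_pos_of_criticalProb_lt_holds G t _ (by show criticalProb G t < (criticalProb G t + (p : ℝ)) / 2; linarith)
  · exfalso
    have e : p = criticalProbIOf G t := Subtype.ext heq.symm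
    subst e
    exact hθ.ne' (hK hPp)

/-! ## §2 Multi-type carrier with proxies: `θ_t(p_c) = 0` and the drop, from the four GEN column obligations -/

namespace PlanarSkeletonFrmFrom

open SkelConc (Consts)

variable {V : Type} {G : SimpleGraph V} [G.LocallyFinite]

/-- **CONTINUITY AT `p_c` AT A BASE TYPE WITH PROXIES, from the GEN column obligations** (GEN twin of U's `…_iff_minimal'`/`…_of_subexponential_case'` ∘ the closure):
let `𝒞₀` be a GEN choice function at proxy radius `D` meeting `GeomHoldsNQFnPxAt`, `RootHoldsNQWFnLKPxAt Lf Kmin`, `FaceHoldsRNQFnLTKPxAt Lf dT Kmin`, `ReachHoldsRHNQFnLKPxAt Lf Kmin`;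
then on every locally finite `G` with a `PlanarSkeletonFrmFrom Φ`, every base vertex `t ∈ Φ.types` with `Φ.HasProxies t D` and subcritical cylinders at `p_c` has `θ_t(p_c) = 0`
— exponential growth: Hutchcroft (connected by `graph_connected`, quasi-transitive by the frames); otherwise the GEN closure top `drop_of_choiceFnNQLTKPx_at` at `p_c` with
`0 < p_c` (`pos_of_theta_pos`), `p_c < 1` (`criticalProb_lt_one`) and Burton–Keane uniqueness (`numInfiniteClusters_le_one`), closed by `theta_criticalProbIOf_eq_zero_of_drop_at`.
[cite: BenjaminiSchramm1996, Conj. 4] [cite: Hutchcroft2016, Thm. 1] [cite: LyonsPeres2016, Thm. 7.6] [cite: KozmaNitzan2024, §4 Theorem 6] -/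
theorem theta_criticalProbIOf_eq_zero_of_choiceFnNQLTKPxAt (Lf : ℕ → ℕ) (dT : ℝ → ℝ) (hdT : ∀ x : ℝ, 0 < x → 0 < dT x) (Kmin : ℕ) {D : ℕ}
    (𝒞₀ : ChoiceFnNQPxAt D) (hGm : GeomHoldsNQFnPxAt 𝒞₀) (hR : RootHoldsNQWFnLKPxAt Lf Kmin 𝒞₀)
    (hF : FaceHoldsRNQFnLTKPxAt Lf dT Kmin 𝒞₀) (hRe : ReachHoldsRHNQFnLKPxAt Lf Kmin 𝒞₀)
    (Φ : PlanarSkeletonFrmFrom G) {t : V} (ht : t ∈ Φ.types) (hP : Φ.HasProxies t D) (hC : Φ.CylSubcritical (criticalProbIOf G t)) :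
    theta G t (criticalProbIOf G t) = 0 := by
  haveI : Countable V := countable_of_connected_of_locallyFinite G (Φ.graph_connected t) t
  by_cases hg : HasExponentialGrowth G
  · exact Hutchcroft2016_noPercolationAtCriticality_holds G (Φ.graph_connected t) Φ.isQuasiTransitive_frmFrom hg t
  · exact theta_criticalProbIOf_eq_zero_of_drop_at G t fun hθ =>
      drop_of_choiceFnNQLTKPx_at Lf dT hdT Kmin 𝒞₀ hGm hR hF hRe Φ hg ht hP _ (PlanarSkeletonSign.pos_of_theta_pos hθ) (Φ.criticalProb_lt_one t)
        (Φ.numInfiniteClusters_le_one hg ht _) hC hθ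

/-- **THE SAME-`p` DROP AT A BASE TYPE WITH PROXIES, from the GEN column obligations — no growth, uniqueness or `p < 1` hypotheses**: under the hypotheses of
`theta_criticalProbIOf_eq_zero_of_choiceFnNQLTKPxAt` on `𝒞₀`, every `p` with subcritical cylinders and `θ_t(p) > 0` admits `q < p` with `θ_t(q) > 0` (§1 ∘ the previous
theorem). [cite: BenjaminiSchramm1996, Conj. 4] [cite: KozmaNitzan2024, §1 p. 2 (approach 1)] -/
theorem drop_of_choiceFnNQLTKPxAt_at (Lf : ℕ → ℕ) (dT : ℝ → ℝ) (hdT : ∀ x : ℝ, 0 < x → 0 < dT x) (Kmin : ℕ) {D : ℕ}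
    (𝒞₀ : ChoiceFnNQPxAt D) (hGm : GeomHoldsNQFnPxAt 𝒞₀) (hR : RootHoldsNQWFnLKPxAt Lf Kmin 𝒞₀)
    (hF : FaceHoldsRNQFnLTKPxAt Lf dT Kmin 𝒞₀) (hRe : ReachHoldsRHNQFnLKPxAt Lf Kmin 𝒞₀)
    (Φ : PlanarSkeletonFrmFrom G) {t : V} (ht : t ∈ Φ.types) (hP : Φ.HasProxies t D) (p : unitInterval) (hC : Φ.CylSubcritical p) (hθ : 0 < theta G t p) :
    ∃ q : unitInterval, (q : ℝ) < p ∧ 0 < theta G t q :=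
  haveI : Countable V := countable_of_connected_of_locallyFinite G (Φ.graph_connected t) t
  drop_at_of_critical G t (P := fun r => Φ.CylSubcritical r)
    (fun hCc => theta_criticalProbIOf_eq_zero_of_choiceFnNQLTKPxAt Lf dT hdT Kmin 𝒞₀ hGm hR hF hRe Φ ht hP hCc) p hC hθ

end PlanarSkeletonFrmFrom

/-! ## §3 One-type SCALED skeletons with `L ≤ N`: through the coarse skeleton and its proxies -/

namespace PlanarSkeletonFrmScaled

open PlanarSkeletonFrmFrom (ChoiceFnNQPxAt GeomHoldsNQFnPxAt RootHoldsNQWFnLKPxAt FaceHoldsRNQFnLTKPxAt ReachHoldsRHNQFnLKPxAt)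

variable {V : Type} {G : SimpleGraph V} [G.LocallyFinite]

/-- **CONTINUITY AT `p_c` FOR A ONE-TYPE SCALED SKELETON WITH `L ≤ N`, from a `D`-indexed family of GEN column obligations** (the shape the U_s node's rider form reads):
if for EVERY radius `D` the GEN choice function `𝒞f D` meets the four obligations, then on a connected locally finite `G` with a one-type `PlanarSkeletonFrmScaled Φ`
(`Φ.types = {t}`, `Φ.L ≤ Φ.N`) and subcritical cylinders at `p_c`, `θ_t(p_c) = 0` — apply §2 to the COARSE skeleton `Φ.coarseFrmFrom h1 hLN` (same graph, `t ∈ types` by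
`mem_coarseFrmFrom_types`, proxies at the radius `D(Φ)` of `hasProxies_coarseFrmFrom`, Φ2 by `coarseFrmFrom_cylSubcritical`).
[cite: BenjaminiSchramm1996, Conj. 4] [cite: KozmaNitzan2024, §4 p. 16 (Lemma 8), pp. 19–21] [cite: MartineauSevero2019, Cor. 2.2] -/
theorem theta_criticalProbIOf_eq_zero_of_choiceFnNQLTKPxAt (Lf : ℕ → ℕ) (dT : ℝ → ℝ) (hdT : ∀ x : ℝ, 0 < x → 0 < dT x) (Kmin : ℕ)
    (𝒞f : ∀ D : ℕ, ChoiceFnNQPxAt D) (hGm : ∀ D, GeomHoldsNQFnPxAt (𝒞f D)) (hR : ∀ D, RootHoldsNQWFnLKPxAt Lf Kmin (𝒞f D))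
    (hF : ∀ D, FaceHoldsRNQFnLTKPxAt Lf dT Kmin (𝒞f D)) (hRe : ∀ D, ReachHoldsRHNQFnLKPxAt Lf Kmin (𝒞f D))
    (Φ : PlanarSkeletonFrmScaled G) (hc : G.Connected) {t : V} (h1 : Φ.types = {t}) (hLN : Φ.L ≤ Φ.N) (hC : Φ.CylSubcritical (criticalProbIOf G t)) :
    theta G t (criticalProbIOf G t) = 0 := by
  haveI : Countable V := countable_of_connected_of_locallyFinite G hc t
  obtain ⟨D, hP⟩ := Φ.hasProxies_coarseFrmFrom hc h1 hLN
  exact PlanarSkeletonFrmFrom.theta_criticalProbIOf_eq_zero_of_choiceFnNQLTKPxAt Lf dT hdT Kmin (𝒞f D) (hGm D) (hR D) (hF D) (hRe D)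
    (Φ.coarseFrmFrom h1 hLN) (Φ.mem_coarseFrmFrom_types h1 hLN) hP (Φ.coarseFrmFrom_cylSubcritical h1 hLN hC)

/-- **THE SAME-`p` DROP FOR A ONE-TYPE SCALED SKELETON WITH `L ≤ N`, from a `D`-indexed family of GEN column obligations** — the rider form's body, pointwise: under the
hypotheses of the previous theorem, every `p` with subcritical cylinders and `θ_t(p) > 0` admits `q < p` with `θ_t(q) > 0` (§1 ∘ §3; `p < 1` and a.s. uniqueness at `p`,
which `SamePDropOfSkeletonFrmScaled₁` lists, are not needed).  The U_s node (Us-4, lead-gated) is this theorem at `𝒞f := fun D => frmChoiceAllQ3VPx D (tuple D)` and the four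
GEN column tops; until then nothing about `SamePDropOfSkeletonFrmScaled₁` is claimed. [cite: BenjaminiSchramm1996, Conj. 4] [cite: KozmaNitzan2024, §1 p. 2, §4] -/
theorem drop_of_choiceFnNQLTKPxAt_at (Lf : ℕ → ℕ) (dT : ℝ → ℝ) (hdT : ∀ x : ℝ, 0 < x → 0 < dT x) (Kmin : ℕ)
    (𝒞f : ∀ D : ℕ, ChoiceFnNQPxAt D) (hGm : ∀ D, GeomHoldsNQFnPxAt (𝒞f D)) (hR : ∀ D, RootHoldsNQWFnLKPxAt Lf Kmin (𝒞f D))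
    (hF : ∀ D, FaceHoldsRNQFnLTKPxAt Lf dT Kmin (𝒞f D)) (hRe : ∀ D, ReachHoldsRHNQFnLKPxAt Lf Kmin (𝒞f D))
    (Φ : PlanarSkeletonFrmScaled G) (hc : G.Connected) {t : V} (h1 : Φ.types = {t}) (hLN : Φ.L ≤ Φ.N) (p : unitInterval) (hC : Φ.CylSubcritical p)
    (hθ : 0 < theta G t p) :
    ∃ q : unitInterval, (q : ℝ) < p ∧ 0 < theta G t q :=
  haveI : Countable V := countable_of_connected_of_locallyFinite G hc t
  drop_at_of_critical G t (P := fun r => Φ.CylSubcritical r)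
    (fun hCc => theta_criticalProbIOf_eq_zero_of_choiceFnNQLTKPxAt Lf dT hdT Kmin 𝒞f hGm hR hF hRe Φ hc h1 hLN hCc) p hC hθ

end PlanarSkeletonFrmScaled

end Summit.CriticalPhenomena.PercolationContinuityZ3.Theorems.Transplant

end
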